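/-
Copyright: statement-level skeleton of a published paper (lit-balaban cell, Phase-2 proof seat p39 gen 3). No proof claims
beyond what the kernel checks below.
-/
import Mathlib.Analysis.SpecialFunctions.Stirling
import Mathlib.Analysis.Complex.ExponentialBounds
import Mathlib.Analysis.SpecialFunctions.Trigonometric.DerivHyp
import Mathlib.Probability.Distributions.Poisson.Basic

/-!
# B3 — T. Bałaban, *(Higgs)₂,₃ quantum fields in a finite volume. III. Renormalization*, CMP **88** (1983) 411–445
[Balaban1983Higgs3], p. 437: towards the printed bound |C^ξ(y−y′)| ≤ O(1)e^{−½|y−y′|}/|y−y′| for the free propagator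
C^ξ = (−Δ^ξ+1)^{−1} — FILE 1/3: the one-dimensional Poissonized kernel (Bessel series) and its tilted Poisson bound

statement-level skeleton of published theorems with citation tags; proofs where landed; nothing here is a claim about
the Yang–Mills mass gap

PDF held: `paper:balaban1983-higgs-2-3-quantum-fields-finite-volume` (journal page = PDF page + 410), p. 437 [PDF 27].
WHAT IS REPRODUCED: kernel infrastructure for row **B3.Eq3.11-3.17** of `HOME/lit-balaban-r15/ROWS-B3.md` (reader/typer r15,
fold owner of B3) — the p. 437 sentence *"Using the inequalities |C^ξ(y − y′)| ≦ O(1)e^{−½|y−y′|}/|y − y′|, … we can estimate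
(3.16) by a constant"*; unit `lit-balaban-p39-g3` (Phase-2 proof seat p39, gen 3), HOME `run/shared/lean/pub/lit-balaban/`.
The paper takes the bound from its general propagator estimates ("(2.10)–(2.12)", [Balaban1982Higgs1] Props. 2.1/2.3) and
prints no proof for the free propagator; the tree has C^ξ as r15's momentum integral `B3Sect3VectorSelfEnergy.Cxi` and as the
position-space Neumann (random-walk) series `B3CxiPropagator.Cxi_eq_neumannK` (C^ξ = βξ^{−d}Σ_kθ^kW_k, θ = (2d+ξ²)^{−1},
β = ξ²θ), whose geometric decay is only lattice-scale (r15's docstring: "not uniform in ξ").  The uniform bound is obtained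
(files 2–3: `B3CxiPoissonization`, `B3CxiUniformBound`) by POISSONIZATION AND SEPARATION OF VARIABLES:
Σ_k θ^kW_k(y) = ∫₀^∞ e^{−t} Π_μ F(θt, |y_μ|) dt with the one-dimensional kernel of this file
F(s,n) = Σ_{j≥0} s^j/j! · s^{j+n}/(j+n)! (= the modified Bessel function I_n(2s); the exponential generating function of the
one-dimensional nearest-neighbour walk counts), and by the TILTED POISSON BOUND proved here:
**F(s,n) ≤ 2(1+s)^{−1/2} exp(2s cosh a − a·n) for all s ≥ 0, a ≥ 0, n ∈ ℕ** (`besselF_le`) — F(s,n)e^{an} =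
e^{se^{−a}+se^{a}} Σ_j Poi_{se^{−a}}(j)·Poi_{se^{a}}(j+n) and the Poisson probability mass function is bounded by
2/√(1+λ) uniformly in the rate λ (`poissonPMF_le`, from Mathlib's Stirling lower bound `Stirling.le_factorial_stirling`).
Optimising a per (s,n) gives both the Gaussian off-diagonal decay and the (1+s)^{−1/2} diagonal decay of the continuous-time
walk, which is what makes the d = 3 bound uniform in the lattice spacing (file 3).  Mathlib only; no new definitions beyond the
two kernels `poissonPMF`, `besselF` (defs with bodies); no named facts.
-/

open scoped BigOperators
open Real

namespace Literature.MathematicalPhysics.QuantumFieldTheory.Balaban1983to89.B3CxiBesselKernel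

noncomputable section

/-! ## 1. The Poisson probability mass function is ≤ 2/√(1+λ), uniformly in the rate -/

/-- The Poisson probability mass function Poi_λ(m) = e^{−λ}λ^m/m! (real-valued; Mathlib's `poissonMeasure` weights).
[cite: Balaban1983Higgs3, (3.16) p.437] -/
def poissonPMF (lam : ℝ) (m : ℕ) : ℝ := Real.exp (-lam) * lam ^ m / m.factorial

/-- kernel: Poi_λ(m) ≥ 0. [cite: Balaban1983Higgs3, (3.16) p.437] -/
theorem poissonPMF_nonneg {lam : ℝ} (hlam : 0 ≤ lam) (m : ℕ) : 0 ≤ poissonPMF lam m := by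
  unfold poissonPMF; positivity

/-- kernel: Σ_m Poi_λ(m) = 1 (Mathlib `ProbabilityTheory.hasSum_one_poissonMeasure`). [cite: Balaban1983Higgs3, (3.16) p.437] -/
theorem hasSum_poissonPMF {lam : ℝ} (hlam : 0 ≤ lam) : HasSum (poissonPMF lam) 1 := by
  exact (ProbabilityTheory.hasSum_one_poissonMeasure ⟨lam, hlam⟩).congr_fun fun m => rfl

/-- kernel: e·x ≤ e^x for every real x (tangent line at x = 1). [folklore] -/
private theorem exp_one_mul_le_exp (x : ℝ) : Real.exp 1 * x ≤ Real.exp x := by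
  have h := Real.add_one_le_exp (x - 1)
  have h2 : Real.exp (x - 1) = Real.exp x / Real.exp 1 := by rw [Real.exp_sub]
  rw [h2, le_div_iff₀ (Real.exp_pos 1)] at h
  linarith

/-- kernel: e·x ≤ e^{3x/4} for x ≥ 4. [folklore] -/
private theorem exp_one_mul_le_exp_three_quarters {x : ℝ} (hx : 4 ≤ x) : Real.exp 1 * x ≤ Real.exp (3 * x / 4) := by
  have he1 : Real.exp 1 < 2.7182818286 := Real.exp_one_lt_d9
  have he1' : 2.7182818283 < Real.exp 1 := Real.exp_one_gt_d9
  have h3 : (20 : ℝ) ≤ Real.exp 3 := by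
    have : Real.exp 3 = Real.exp 1 ^ 3 := by rw [← Real.exp_nat_mul]; norm_num
    rw [this]
    have h' : (2.7182818283 : ℝ) ^ 3 ≤ Real.exp 1 ^ 3 := pow_le_pow_left₀ (by norm_num) he1'.le 3
    nlinarith [h']
  have h4 : Real.exp 3 * (1 + (3 * x / 4 - 3)) ≤ Real.exp (3 * x / 4) := by
    have := Real.add_one_le_exp (3 * x / 4 - 3)
    have hsplit : Real.exp (3 * x / 4) = Real.exp 3 * Real.exp (3 * x / 4 - 3) := by
      rw [← Real.exp_add]; ring_nf
    rw [hsplit]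
    exact mul_le_mul_of_nonneg_left (by linarith) (Real.exp_pos 3).le
  nlinarith [h3, h4, he1, hx]

/-- kernel: Stirling in the form e^{−λ}λ^m/m! ≤ (eλ/m)^m e^{−λ}/√(2πm) for m ≥ 1. [folklore] -/
private theorem poissonPMF_le_stirling {lam : ℝ} (hlam : 0 ≤ lam) {m : ℕ} (hm : m ≠ 0) :
    poissonPMF lam m ≤ Real.exp (-lam) * (Real.exp 1 * lam / m) ^ m / Real.sqrt (2 * Real.pi * m) := by
  have hst := Stirling.le_factorial_stirling m
  have hmpos : (0 : ℝ) < m := by exact_mod_cast Nat.pos_of_ne_zero hm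
  have hsq : 0 < Real.sqrt (2 * Real.pi * m) := Real.sqrt_pos.2 (by positivity)
  have hden : 0 < Real.sqrt (2 * Real.pi * m) * (m / Real.exp 1) ^ m := by positivity
  unfold poissonPMF
  calc Real.exp (-lam) * lam ^ m / m.factorial
      ≤ Real.exp (-lam) * lam ^ m / (Real.sqrt (2 * Real.pi * m) * (m / Real.exp 1) ^ m) :=
        div_le_div_of_nonneg_left (by positivity) hden hst
    _ = Real.exp (-lam) * (Real.exp 1 * lam / m) ^ m / Real.sqrt (2 * Real.pi * m) := by
        have he : Real.exp 1 ≠ 0 := (Real.exp_pos 1).ne'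
        rw [div_pow, div_pow, mul_pow]
        field_simp

/-- **The Poisson probability mass function is bounded by 2/√(1+λ)**, uniformly in the rate λ ≥ 0 and the argument m
(Stirling's lower bound m! ≥ √(2πm)(m/e)^m; the regimes 4m ≥ λ, where (eλ/m)^m ≤ e^λ, and 4m < λ, where (eλ/m)^m ≤ e^{3λ/4}).
[cite: Balaban1983Higgs3, (3.16) p.437] -/
theorem poissonPMF_le {lam : ℝ} (hlam : 0 ≤ lam) (m : ℕ) : poissonPMF lam m ≤ 2 / Real.sqrt (1 + lam) := by
  have hsq1 : 0 < Real.sqrt (1 + lam) := Real.sqrt_pos.2 (by linarith)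
  have hsq1' : Real.sqrt (1 + lam) ≤ 2 * Real.exp (lam / 4) := by
    -- 1 + λ ≤ 4 e^{λ/2} = (2 e^{λ/4})²
    have h1 : 1 + lam ≤ (2 * Real.exp (lam / 4)) ^ 2 := by
      have := Real.add_one_le_exp (lam / 2)
      have hsq : (2 * Real.exp (lam / 4)) ^ 2 = 4 * Real.exp (lam / 2) := by
        rw [mul_pow, ← Real.exp_nat_mul]; ring_nf
      rw [hsq]; linarith
    calc Real.sqrt (1 + lam) ≤ Real.sqrt ((2 * Real.exp (lam / 4)) ^ 2) := Real.sqrt_le_sqrt h1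
      _ = 2 * Real.exp (lam / 4) := Real.sqrt_sq (by positivity)
  rcases Nat.eq_zero_or_pos m with hm | hm
  · -- m = 0: e^{−λ} ≤ 1/√(1+λ)
    subst hm
    simp only [poissonPMF, pow_zero, Nat.factorial_zero, Nat.cast_one, mul_one, div_one]
    rw [le_div_iff₀ hsq1]
    have : Real.sqrt (1 + lam) ≤ 2 * Real.exp lam := by
      refine hsq1'.trans ?_
      have := Real.exp_le_exp.2 (show lam / 4 ≤ lam by linarith)
      linarith
    calc Real.exp (-lam) * Real.sqrt (1 + lam) ≤ Real.exp (-lam) * (2 * Real.exp lam) :=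
          mul_le_mul_of_nonneg_left this (Real.exp_pos _).le
      _ = 2 := by rw [mul_comm, mul_assoc, ← Real.exp_add, add_neg_cancel, Real.exp_zero, mul_one]
  have hm0 : m ≠ 0 := Nat.pos_iff_ne_zero.1 hm
  have hmpos : (0 : ℝ) < m := by exact_mod_cast hm
  have hm1 : (1 : ℝ) ≤ m := by exact_mod_cast hm
  have hst := poissonPMF_le_stirling hlam hm0
  have hsq : 0 < Real.sqrt (2 * Real.pi * m) := Real.sqrt_pos.2 (by positivity)
  set x : ℝ := lam / m with hx
  have hxnn : 0 ≤ x := div_nonneg hlam hmpos.le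
  have hlamx : lam = x * m := by rw [hx]; field_simp
  -- (eλ/m)^m = (e x)^m
  have hpow : (Real.exp 1 * lam / m) ^ m = (Real.exp 1 * x) ^ m := by rw [hx, mul_div_assoc]
  by_cases hcase : lam ≤ 4 * m
  · -- regime 4m ≥ λ: (e x)^m ≤ (e^x)^m = e^λ, so Poi ≤ 1/√(2πm) ≤ 2/√(1+λ)
    have h1 : (Real.exp 1 * x) ^ m ≤ Real.exp lam := by
      calc (Real.exp 1 * x) ^ m ≤ Real.exp x ^ m :=
            pow_le_pow_left₀ (by positivity) (exp_one_mul_le_exp x) m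
        _ = Real.exp lam := by rw [← Real.exp_nat_mul, hlamx, mul_comm]
    have h2 : poissonPMF lam m ≤ 1 / Real.sqrt (2 * Real.pi * m) := by
      refine hst.trans ?_
      rw [hpow, div_le_div_iff_of_pos_right hsq]
      calc Real.exp (-lam) * (Real.exp 1 * x) ^ m ≤ Real.exp (-lam) * Real.exp lam :=
            mul_le_mul_of_nonneg_left h1 (Real.exp_pos _).le
        _ = 1 := by rw [← Real.exp_add, neg_add_cancel, Real.exp_zero]
    refine h2.trans ?_
    -- 1/√(2πm) ≤ 2/√(1+λ)  ⇐  1 + λ ≤ 4·(2πm)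
    rw [div_le_div_iff₀ hsq hsq1, one_mul]
    have hpi : (2 : ℝ) ≤ Real.pi := Real.two_le_pi
    have h3 : 1 + lam ≤ 4 * (2 * Real.pi * m) := by nlinarith
    calc Real.sqrt (1 + lam) ≤ Real.sqrt (4 * (2 * Real.pi * m)) := Real.sqrt_le_sqrt h3
      _ = 2 * Real.sqrt (2 * Real.pi * m) := by
          rw [Real.sqrt_mul (by norm_num), show Real.sqrt 4 = 2 by
            rw [show (4 : ℝ) = 2 ^ 2 by norm_num, Real.sqrt_sq (by norm_num)]]
  · -- regime 4m < λ: x ≥ 4, (e x)^m ≤ (e^{3x/4})^m = e^{3λ/4}, so Poi ≤ e^{−λ/4}/√(2πm) ≤ e^{−λ/4} ≤ 2/√(1+λ)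
    push Not at hcase
    have hx4 : 4 ≤ x := by
      rw [hx, le_div_iff₀ hmpos]; linarith
    have h1 : (Real.exp 1 * x) ^ m ≤ Real.exp (3 * lam / 4) := by
      calc (Real.exp 1 * x) ^ m ≤ Real.exp (3 * x / 4) ^ m :=
            pow_le_pow_left₀ (by positivity) (exp_one_mul_le_exp_three_quarters hx4) m
        _ = Real.exp (3 * lam / 4) := by rw [← Real.exp_nat_mul, hlamx]; ring_nf
    have h2 : poissonPMF lam m ≤ Real.exp (-(lam / 4)) := by
      refine hst.trans ?_
      rw [hpow, div_le_iff₀ hsq]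
      have hs1 : 1 ≤ Real.sqrt (2 * Real.pi * m) := by
        rw [show (1 : ℝ) = Real.sqrt 1 by simp]
        exact Real.sqrt_le_sqrt (by nlinarith [Real.two_le_pi])
      calc Real.exp (-lam) * (Real.exp 1 * x) ^ m ≤ Real.exp (-lam) * Real.exp (3 * lam / 4) :=
            mul_le_mul_of_nonneg_left h1 (Real.exp_pos _).le
        _ = Real.exp (-(lam / 4)) := by rw [← Real.exp_add]; ring_nf
        _ ≤ Real.exp (-(lam / 4)) * Real.sqrt (2 * Real.pi * m) :=
            le_mul_of_one_le_right (Real.exp_pos _).le hs1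
    refine h2.trans ?_
    rw [le_div_iff₀ hsq1]
    calc Real.exp (-(lam / 4)) * Real.sqrt (1 + lam) ≤ Real.exp (-(lam / 4)) * (2 * Real.exp (lam / 4)) :=
          mul_le_mul_of_nonneg_left hsq1' (Real.exp_pos _).le
      _ = 2 := by rw [mul_comm, mul_assoc, ← Real.exp_add, add_neg_cancel, Real.exp_zero, mul_one]

/-! ## 2. The one-dimensional Poissonized kernel F(s,n) = Σ_j s^j/j! · s^{j+n}/(j+n)! (= I_n(2s)) -/

variable {s a : ℝ}

/-- The summand s^j/j! · s^{j+n}/(j+n)! of the Bessel series. [cite: Balaban1983Higgs3, (3.16) p.437] -/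
def besselTerm (s : ℝ) (n j : ℕ) : ℝ := s ^ j / j.factorial * (s ^ (j + n) / (j + n).factorial)

/-- The one-dimensional Poissonized nearest-neighbour kernel F(s,n) = Σ_{j≥0} s^j/j! · s^{j+n}/(j+n)! — the modified Bessel
function I_n(2s), i.e. the exponential generating function Σ_m s^m/m!·#{m-step ±1 walks 0 → n} (j = number of down-steps).
[cite: Balaban1983Higgs3, (3.16) p.437] -/
def besselF (s : ℝ) (n : ℕ) : ℝ := ∑' j : ℕ, besselTerm s n j

/-- kernel: the Bessel summand is ≥ 0 for s ≥ 0. [cite: Balaban1983Higgs3, (3.16) p.437] -/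
theorem besselTerm_nonneg (hs : 0 ≤ s) (n j : ℕ) : 0 ≤ besselTerm s n j := by
  unfold besselTerm; positivity

/-- kernel: the Bessel summand is dominated by e^s · s^j/j!. [cite: Balaban1983Higgs3, (3.16) p.437] -/
theorem besselTerm_le (hs : 0 ≤ s) (n j : ℕ) : besselTerm s n j ≤ Real.exp s * (s ^ j / j.factorial) := by
  unfold besselTerm
  rw [mul_comm (Real.exp s)]
  exact mul_le_mul_of_nonneg_left (Real.pow_div_factorial_le_exp (hx := hs) (n := j + n)) (by positivity)

/-- kernel: the Bessel series converges (absolutely) for s ≥ 0. [cite: Balaban1983Higgs3, (3.16) p.437] -/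
theorem summable_besselTerm (hs : 0 ≤ s) (n : ℕ) : Summable (besselTerm s n) :=
  Summable.of_nonneg_of_le (besselTerm_nonneg hs n) (besselTerm_le hs n)
    ((Real.summable_pow_div_factorial s).mul_left (Real.exp s))

/-- kernel: the Bessel series sums to F(s,n) (s ≥ 0). [cite: Balaban1983Higgs3, (3.16) p.437] -/
theorem hasSum_besselF (hs : 0 ≤ s) (n : ℕ) : HasSum (besselTerm s n) (besselF s n) :=
  (summable_besselTerm hs n).hasSum

/-- kernel: F(s,n) ≥ 0 for s ≥ 0. [cite: Balaban1983Higgs3, (3.16) p.437] -/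
theorem besselF_nonneg (hs : 0 ≤ s) (n : ℕ) : 0 ≤ besselF s n :=
  tsum_nonneg (besselTerm_nonneg hs n)

/-- kernel: F(0,n) = [n = 0] (no time elapsed: the walk is at the origin). [cite: Balaban1983Higgs3, (3.16) p.437] -/
theorem besselF_zero_left (n : ℕ) : besselF 0 n = if n = 0 then 1 else 0 := by
  unfold besselF
  have h : ∀ j : ℕ, besselTerm 0 n j = if j = 0 then (if n = 0 then 1 else 0) else 0 := by
    intro j
    unfold besselTerm
    rcases Nat.eq_zero_or_pos j with hj | hj
    · subst hj
      by_cases hn : n = 0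
      · subst hn; simp
      · simp [hn, zero_pow hn]
    · simp [zero_pow (Nat.pos_iff_ne_zero.1 hj), Nat.pos_iff_ne_zero.1 hj]
  simp_rw [h]
  rw [tsum_ite_eq]

/-- kernel: F(s,n) ≤ e^{2s} crude bound (a = 0 below would give 2e^{2s}/√(1+s); this one is e^s·Σ s^j/j! = e^{2s}).
[cite: Balaban1983Higgs3, (3.16) p.437] -/
theorem besselF_le_exp_two_mul (hs : 0 ≤ s) (n : ℕ) : besselF s n ≤ Real.exp (2 * s) := by
  have h1 : HasSum (fun j : ℕ => Real.exp s * (s ^ j / j.factorial)) (Real.exp s * Real.exp s) := by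
    have := (NormedSpace.expSeries_div_hasSum_exp s).mul_left (Real.exp s)
    rwa [← Real.exp_eq_exp_ℝ] at this
  have h2 := hasSum_le (besselTerm_le hs n) (hasSum_besselF hs n) h1
  rwa [← Real.exp_add, ← two_mul] at h2

/-- kernel (the tilting identity): s^j/j!·s^{j+n}/(j+n)!·e^{an} = e^{λ₁+λ₂}·Poi_{λ₁}(j)·Poi_{λ₂}(j+n) with λ₁ = se^{−a}, λ₂ = se^{a}.
[cite: Balaban1983Higgs3, (3.16) p.437] -/
theorem besselTerm_mul_exp (s a : ℝ) (n j : ℕ) :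
    besselTerm s n j * Real.exp (a * n) =
      Real.exp (s * Real.exp (-a) + s * Real.exp a) *
        (poissonPMF (s * Real.exp (-a)) j * poissonPMF (s * Real.exp a) (j + n)) := by
  have h1 : Real.exp (-a) ^ j * Real.exp a ^ (j + n) = Real.exp (a * n) := by
    rw [← Real.exp_nat_mul, ← Real.exp_nat_mul, ← Real.exp_add]
    congr 1
    push_cast
    ring
  have h2 : Real.exp (s * Real.exp (-a) + s * Real.exp a) *
      (Real.exp (-(s * Real.exp (-a))) * Real.exp (-(s * Real.exp a))) = 1 := by
    rw [← Real.exp_add, ← Real.exp_add, ← Real.exp_zero]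
    congr 1
    ring
  unfold besselTerm poissonPMF
  rw [mul_pow, mul_pow, ← h1]
  calc s ^ j / j.factorial * (s ^ (j + n) / (j + n).factorial) * (Real.exp (-a) ^ j * Real.exp a ^ (j + n))
      = (Real.exp (s * Real.exp (-a) + s * Real.exp a) *
          (Real.exp (-(s * Real.exp (-a))) * Real.exp (-(s * Real.exp a)))) *
          (s ^ j / j.factorial * (s ^ (j + n) / (j + n).factorial) * (Real.exp (-a) ^ j * Real.exp a ^ (j + n))) := by
        rw [h2, one_mul]
    _ = _ := by ring

/-- **The tilted Poisson bound**: F(s,n)·e^{an} ≤ 2(1+s)^{−1/2}·e^{2s cosh a} for s ≥ 0, a ≥ 0 (after tilting, the j-sum is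
Σ_j Poi_{se^{−a}}(j)·Poi_{se^{a}}(j+n) ≤ sup_m Poi_{se^{a}}(m) ≤ 2/√(1+se^{a}) ≤ 2/√(1+s)). [cite: Balaban1983Higgs3, (3.16) p.437] -/
theorem besselF_mul_exp_le (hs : 0 ≤ s) (ha : 0 ≤ a) (n : ℕ) :
    besselF s n * Real.exp (a * n) ≤ 2 / Real.sqrt (1 + s) * Real.exp (2 * s * Real.cosh a) := by
  set lam1 : ℝ := s * Real.exp (-a) with hlam1
  set lam2 : ℝ := s * Real.exp a with hlam2
  have hl1 : 0 ≤ lam1 := by positivity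
  have hl2 : 0 ≤ lam2 := by positivity
  have hs2 : s ≤ lam2 := by
    rw [hlam2]
    exact le_mul_of_one_le_right hs (Real.one_le_exp ha)
  have hcosh : lam1 + lam2 = 2 * s * Real.cosh a := by
    rw [hlam1, hlam2, Real.cosh_eq]; ring
  have hsq : 0 < Real.sqrt (1 + s) := Real.sqrt_pos.2 (by linarith)
  -- termwise bound
  have hpt : ∀ j : ℕ, besselTerm s n j * Real.exp (a * n) ≤
      2 / Real.sqrt (1 + s) * Real.exp (2 * s * Real.cosh a) * poissonPMF lam1 j := by
    intro j
    rw [besselTerm_mul_exp, ← hlam1, ← hlam2, hcosh]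
    have hP2 : poissonPMF lam2 (j + n) ≤ 2 / Real.sqrt (1 + s) := by
      refine (poissonPMF_le hl2 (j + n)).trans ?_
      exact div_le_div_of_nonneg_left (by norm_num) hsq (Real.sqrt_le_sqrt (by linarith))
    have hP1 : 0 ≤ poissonPMF lam1 j := poissonPMF_nonneg hl1 j
    calc Real.exp (2 * s * Real.cosh a) * (poissonPMF lam1 j * poissonPMF lam2 (j + n))
        ≤ Real.exp (2 * s * Real.cosh a) * (poissonPMF lam1 j * (2 / Real.sqrt (1 + s))) :=
          mul_le_mul_of_nonneg_left (mul_le_mul_of_nonneg_left hP2 hP1) (Real.exp_pos _).le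
      _ = 2 / Real.sqrt (1 + s) * Real.exp (2 * s * Real.cosh a) * poissonPMF lam1 j := by ring
  have hL : HasSum (fun j => besselTerm s n j * Real.exp (a * n)) (besselF s n * Real.exp (a * n)) :=
    (hasSum_besselF hs n).mul_right _
  have hR : HasSum (fun j => 2 / Real.sqrt (1 + s) * Real.exp (2 * s * Real.cosh a) * poissonPMF lam1 j)
      (2 / Real.sqrt (1 + s) * Real.exp (2 * s * Real.cosh a) * 1) := (hasSum_poissonPMF hl1).mul_left _
  rw [mul_one] at hR
  exact hasSum_le hpt hL hR

/-- **F(s,n) ≤ 2(1+s)^{−1/2} exp(2s cosh a − a·n)** for all s ≥ 0, a ≥ 0, n ∈ ℕ — the one-dimensional estimate behind the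
uniform bound on C^ξ: the free parameter a is the exponential tilt (a ~ n/(4s) captures the Gaussian off-diagonal decay
e^{−n²/(8κs)}, a fixed captures e^{−an}; a = 0 is the diagonal bound 2e^{2s}/√(1+s)). [cite: Balaban1983Higgs3, (3.16) p.437] -/
theorem besselF_le (hs : 0 ≤ s) (ha : 0 ≤ a) (n : ℕ) :
    besselF s n ≤ 2 / Real.sqrt (1 + s) * Real.exp (2 * s * Real.cosh a - a * n) := by
  have h := besselF_mul_exp_le hs ha n
  rw [Real.exp_sub, mul_div_assoc', le_div_iff₀ (Real.exp_pos _)]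
  exact h

/-- kernel: the diagonal case a = 0: F(s,n) ≤ 2e^{2s}/√(1+s). [cite: Balaban1983Higgs3, (3.16) p.437] -/
theorem besselF_le_diag (hs : 0 ≤ s) (n : ℕ) : besselF s n ≤ 2 / Real.sqrt (1 + s) * Real.exp (2 * s) := by
  have h := besselF_le hs le_rfl n
  rwa [Real.cosh_zero, mul_one, zero_mul, sub_zero] at h

end

end Literature.MathematicalPhysics.QuantumFieldTheory.Balaban1983to89.B3CxiBesselKernel
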